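import Summits.QuantumFields.BalabanUV.Beta.RelInvComposite
import Summits.QuantumFields.BalabanUV.Beta.CompositeCorrectorBordered
import Summits.QuantumFields.BalabanUV.Beta.CompositeCorrectorKernelSpr
import Summits.QuantumFields.BalabanUV.Beta.D1BFx.SortedRelInv
import Summits.QuantumFields.BalabanUV.Beta.AxialDressingRootedLinear
import Summits.QuantumFields.BalabanUV.Beta.BorderedHessianStep
import Summits.QuantumFields.BalabanUV.Beta.FP.TorusCompositeObjects

/-!
# `BalabanUV.Beta.CompositeOneShotChart` — binder row D1, (C1)-0: **THE SEVEN CHART LETTERS OF THE COMPOSITE ONE-SHOT CHART OF RECORD** — K-U3d's pair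
# `(A_X, 𝕄_X) := (Ψ̂_m ∘ coDressKBmAt ρ N (KInv N) ∘ Ψ̂_mᵀ, bhKcomp r L m = Φ̂_mᵀ ∘ bhK N ∘ Φ̂_m)`, `N = L^m`: spread ×2, `N`-block covariance ×2, the relative-inverse rules
# (`RelInvComposite.relInv_composite`, re-rooted), the vanishing multiplier block and the mixed-block antisymmetry of `𝕄_X`; the `ff` block of `𝕄_X` = that of the
# level-`0` step form; and the same letters in the tower's spelling (`Lc`, depth `m+1`, big root `bigRoot Lc rs m`) = the displayed hypotheses
# `hA hMh hAt hMt hrel hmm hanti` of leaf-05's `FP/PackedLegOneShotSockets` §1, AT FULL DEPTH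
# (β sub-cell, BINDER-OWNERS row D1 ∕ (C1) OWNER `b2b-balaban-beta-an2`, gen 48; W-an2-g48-3 ∕ A-3; STAGED offer)

HONEST FRAMING (cell charter, verbatim): «discharging BetaPertH makes Bałaban's UV stability UNCONDITIONAL — a real constructive-QFT result; it is
NOT the continuum limit and NOT the Clay problem.»  HONEST DEPENDENCY: continuum YM on T⁴ ⇐ BetaPertH ∧ nine spine estimates (0/9 proved);
BetaPertH ⇐ (D1) ∧ (D4) ∧ CAP+tail; G-an2-4 gates asym, D1 and NE2/3/4.
NOT IN PRINT; OUR BOOKKEEPING.  [folklore] closure bookkeeping BY NAME over K-U3d (`RelInvComposite.relInv_composite`, `CompositeCorrectorKernelSpr.spr_psiK ∕ spr_phiK ∕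
shiftK_psiK ∕ shiftK_phiK`, `CompositeCorrectorBordered` §3), `spr_coDressKBmAt ∕ shiftK_coDressKBmAt`, `spr_KInv ∕ shiftK_KInv`, `spr_bhK`, `D1BFx.SortedRelInv.shiftK_bhK`,
`bhKStepAt_zero ∕ bhKAt_inl_inl`, leaf-06's `bigRoot_range`; no statement of Bałaban's papers, no `[cite:]`, no `def`, no `def … : Prop`; instantiates NO binder of the
β-function wall.  WHAT IT DOES NOT DO: the BORDER block identification `hQ` of leaf-05's sockets at the torus (it carries the unit `∏_k stepScale d Lc (lev k)` of `Q₂₀·compRows`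
against `bhKcomp`'s bare `compLinAvgAt` border, A-3) and the one-shot TABLES (`tabsComp`, suppliers') are NOT here (`hH` IS here, §3, at full depth);
for a truncated tower (`lev (n+1) ≥ 1`) the base pair is not in the tree (A-3).  NOT (C1), NOT D1, NOT `BetaPertH`, NOT continuum, NOT Clay.

* §1 (K-U3d literal: `L`, `m`, in-block per-level roots `r k`, big root `toSite s`, `s ∈ box (L^m)`): **`spr_compositeA`**, **`spr_bhKcomp`**, **`shiftK_compositeA`**,
  **`shiftK_bhKcomp`**, **`bhKcomp_inr_inr`**, **`bhKcomp_inl_inr_eq_neg`**, and **`bhKcomp_inl_inl_eq_bhKStepAt_zero`** (the `ff` block of `bhKcomp` IS the `ff` block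
  of the level-`0` step form `bhKStepAt d ρ Lc 0`, entrywise — both the windowed `d*d`, corrector-blind and ratio-free).
* §2 (tower spelling: `Lc`, depth `m+1`, scale `Lc^(m+1)` (`= bigRatio Lc m`, `TorusCompositeObjects.bigRatio_eq_pow`, to be `rw`n by the consumer), big root
  `bigRoot Lc rs m` from leaf-05∕#41d's `hrs`): `exists_box_toSite_eq_bigRoot` and the seven letters **`tower_spr_A ∕ tower_spr_M ∕ tower_shiftK_A ∕ tower_shiftK_M ∕
  tower_relInv ∕ tower_mm ∕ tower_anti`** in leaf-05's hypothesis shapes (`Spr`, `∀ t, shiftK ((N : ℤ) • t) · = ·`, `RelInv A Mh (axEc (bigRoot Lc rs m) N)`,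
  `∀ x y κ l, Mh x y (inr κ) (inr l) = 0`, `∀ x y κ l, Mh x y (inl κ) (inr l) = −Mh y x (inr l) (inl κ)`).
* §3 (the torus `hH` identification, full depth): **`perF_submatrix_inl_inl_congr`** (the periodised `ff` submatrix sees only the kernel's `ff` block) and
  **`perF_bhKcomp_submatrix_inl_inl_eq`**: `(perF T (bhKcomp r L m))|ff = (perF T (bhKStepAt d ρ Lc 0))|ff` for every torus box `T`, root `ρ`, ratio `Lc` = leaf-05's ∕ #41d's
  `hH` with `H₀ := (perF T (bhKStepAt … (lev (n+1))))|ff` at `lev (n+1) = 0`.  STILL NOT HERE: `hQ` (the border identification with its unit), the tables.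
Provenance: β sub-cell, unit beta-an2 gen 48, 2026-08-23 (v1.2: `open` block scoped inside the namespace, concat-friendly per leaf-05 g37 W-2); no existing file touched.
-/

namespace Summit.QuantumFields.BalabanUV.Beta.CompositeOneShotChart

open Literature.MathematicalPhysics.QuantumFieldTheory.Balaban1983to89
open Literature.MathematicalPhysics.QuantumFieldTheory.Balaban1983to89.Beta
open ExpKernelCalculus (MKer comp shiftK comp_shiftK)
open AffineAveraging (Site box toSite)
open OneStepResolventKernel (Fib KInv shiftK_KInv)
open Summit.QuantumFields.BalabanUV.Beta.TameKernelCalculus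
open Summit.QuantumFields.BalabanUV.Beta.ChartConjugationRelative (RelInv spr_comp)
open Summit.QuantumFields.BalabanUV.Beta.AxialDressingRooted (coDressKBmAt axEc spr_coDressKBmAt shiftK_coDressKBmAt trK_shiftK)
open Summit.QuantumFields.BalabanUV.Beta.BorderedHessian (bhK bhKAt bhKStepAt bhKStepAt_zero bhKAt_inl_inl spr_bhK spr_KInv)
open Summit.QuantumFields.BalabanUV.Beta.CompositeCorrectorKernel (psiK phiK spr_psiK spr_phiK spr_trK_psiK spr_trK_phiK shiftK_psiK shiftK_phiK)
open Summit.QuantumFields.BalabanUV.Beta.RelInvComposite (bhKcomp bhKcomp_eq relInv_composite)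
open Summit.QuantumFields.BalabanUV.Beta.CompositeCorrectorBordered (trK_phiK_bhK_phiK_inl_inl trK_phiK_bhK_phiK_inr_inr trK_phiK_bhK_phiK_inl_inr
  trK_phiK_bhK_phiK_inr_inl)
open Summit.QuantumFields.BalabanUV.Beta.D1BFx.SortedRelInv (shiftK_bhK)
open Summit.QuantumFields.BalabanUV.Beta.FP.TorusCompositeObjects (bigRatio bigRoot bigRatio_eq_pow bigRoot_range)

noncomputable section

variable {d : ℕ}

/-! ## §1 The letters at K-U3d's literal -/

section Literal

variable {L : ℕ}

/-- [folklore] `hA`: the composite one-shot resolvent `Ψ̂_m ∘ coDressKBmAt (toSite s) (L^m) (KInv (L^m)) ∘ Ψ̂_mᵀ` is spread. -/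
theorem spr_compositeA (hL : 0 < L) {r : ℕ → (Fin (d + 1) → ℕ)} (hr : ∀ k, r k ∈ box (d + 1) L) (m : ℕ)
    {s : Fin (d + 1) → ℕ} (hs : s ∈ box (d + 1) (L ^ m)) [NeZero (L ^ m)] :
    Spr (comp (comp (psiK r L m) (coDressKBmAt (toSite s) (L ^ m) (KInv (N := L ^ m) (d := d)))) (trK (psiK r L m))) :=
  spr_comp (spr_comp (spr_psiK hL hr m) (spr_coDressKBmAt (Nat.one_le_iff_ne_zero.mpr (NeZero.ne (L ^ m))) hs spr_KInv))
    (spr_trK_psiK hL hr m)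

/-- [folklore] `hMh`: `bhKcomp r L m` is spread. -/
theorem spr_bhKcomp (hL : 0 < L) {r : ℕ → (Fin (d + 1) → ℕ)} (hr : ∀ k, r k ∈ box (d + 1) L) (m : ℕ) [NeZero (L ^ m)] :
    Spr (bhKcomp (d := d) r L m) := by
  rw [bhKcomp_eq]
  exact spr_comp (spr_comp (spr_trK_phiK hL hr m) (spr_bhK (Nat.one_le_iff_ne_zero.mpr (NeZero.ne (L ^ m))))) (spr_phiK hL hr m)

/-- [folklore] `hAt`: the composite one-shot resolvent is covariant under `L^m`-block translations, for ANY root `ρ` (`shiftK_psiK`, `shiftK_coDressKBmAt` over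
`shiftK_KInv`, `comp_shiftK ∕ trK_shiftK`). -/
theorem shiftK_compositeA (hL : 1 ≤ L) (r : ℕ → (Fin (d + 1) → ℕ)) (m : ℕ) (ρ : Fin (d + 1) → ℤ) [NeZero (L ^ m)] (v : Fin (d + 1) → ℤ) :
    shiftK ((((L ^ m : ℕ) : ℤ)) • v)
        (comp (comp (psiK r L m) (coDressKBmAt ρ (L ^ m) (KInv (N := L ^ m) (d := d)))) (trK (psiK r L m))) =
      comp (comp (psiK r L m) (coDressKBmAt ρ (L ^ m) (KInv (N := L ^ m) (d := d)))) (trK (psiK r L m)) := by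
  have hG := shiftK_coDressKBmAt ρ (Nat.one_le_iff_ne_zero.mpr (NeZero.ne (L ^ m)))
    (K := KInv (N := L ^ m) (d := d)) (fun t => shiftK_KInv (N := L ^ m) t) (-v)
  rw [smul_neg, neg_neg] at hG
  rw [← comp_shiftK, ← comp_shiftK, ← trK_shiftK, shiftK_psiK hL r m v, hG]

/-- [folklore] `hMt`: `bhKcomp r L m` is covariant under `L^m`-block translations (`shiftK_phiK` through `comp_shiftK ∕ trK_shiftK`, `SortedRelInv.shiftK_bhK`). -/
theorem shiftK_bhKcomp (hL : 1 ≤ L) (r : ℕ → (Fin (d + 1) → ℕ)) (m : ℕ) [NeZero (L ^ m)] (v : Fin (d + 1) → ℤ) :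
    shiftK ((((L ^ m : ℕ) : ℤ)) • v) (bhKcomp (d := d) r L m) = bhKcomp r L m := by
  rw [bhKcomp_eq, ← comp_shiftK, ← comp_shiftK, ← trK_shiftK, shiftK_phiK hL r m v, shiftK_bhK]

/-- [folklore] `hmm`: the multiplier–multiplier block of `bhKcomp` vanishes. -/
theorem bhKcomp_inr_inr (r : ℕ → (Fin (d + 1) → ℕ)) (m : ℕ) (x z : Fin (d + 1) → ℤ) (μ μ' : Fin (d + 1)) :
    bhKcomp r L m x z (Sum.inr μ) (Sum.inr μ') = 0 := by
  rw [bhKcomp_eq]; exact trK_phiK_bhK_phiK_inr_inr r m x z μ μ'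

/-- [folklore] `hanti`: the mixed blocks of `bhKcomp` are antisymmetric under transposition. -/
theorem bhKcomp_inl_inr_eq_neg (hL : 0 < L) (r : ℕ → (Fin (d + 1) → ℕ)) (m : ℕ) (x z : Fin (d + 1) → ℤ) (α μ : Fin (d + 1)) :
    bhKcomp r L m x z (Sum.inl α) (Sum.inr μ) = -bhKcomp r L m z x (Sum.inr μ) (Sum.inl α) := by
  rw [bhKcomp_eq, trK_phiK_bhK_phiK_inl_inr r m hL, trK_phiK_bhK_phiK_inr_inl r m hL]
  split_ifs <;> simp

/-- [folklore] **THE (C1)-0 `hH` JUNCTION AT FULL DEPTH, ENTRYWISE**: the `ff` block of `bhKcomp r L m` IS the `ff` block of the level-`0` step form `bhKStepAt d ρ Lc 0`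
(`= bhKAt`): both are the windowed `d*d`, corrector-blind (`trK_phiK_bhK_phiK_inl_inl`) and ratio-free (`bhK`'s `ff` entry does not depend on the blocking). -/
theorem bhKcomp_inl_inl_eq_bhKStepAt_zero (hL : 0 < L) (r : ℕ → (Fin (d + 1) → ℕ)) (m : ℕ) (ρ : Fin (d + 1) → ℤ) (Lc : ℕ) [NeZero Lc]
    (x z : Fin (d + 1) → ℤ) (κ β : Fin (d + 1)) :
    bhKcomp r L m x z (Sum.inl κ) (Sum.inl β) = bhKStepAt d ρ Lc 0 x z (Sum.inl κ) (Sum.inl β) := by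
  rw [bhKcomp_eq, trK_phiK_bhK_phiK_inl_inl r m hL, bhKStepAt_zero, bhKAt_inl_inl]
  rfl

end Literal

/-! ## §2 The tower's spelling: `Lc`, depth `m+1`, scale `Lc^(m+1)` (`= bigRatio Lc m`), big root `bigRoot Lc rs m` -/

section Tower

variable (Lc : ℕ) [NeZero Lc]

/-- [folklore] The big root offset of the tower IS an in-box `toSite`: `∃ s ∈ box (Lc^(m+1)), toSite s = bigRoot Lc rs m` (leaf-06's `bigRoot_range` + `bigRatio_eq_pow`). -/
theorem exists_box_toSite_eq_bigRoot (rs : ℕ → (Fin (d + 1) → ℕ)) (hrs : ∀ k i, 0 ≤ toSite (rs k) i ∧ toSite (rs k) i < (Lc : ℤ)) (m : ℕ) :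
    ∃ s : Fin (d + 1) → ℕ, s ∈ box (d + 1) (Lc ^ (m + 1)) ∧ toSite s = bigRoot Lc rs m := by
  have h := bigRoot_range Lc (Nat.pos_of_ne_zero (NeZero.ne Lc)) m rs hrs
  rw [bigRatio_eq_pow] at h
  refine ⟨fun i => (bigRoot Lc rs m i).toNat, Fintype.mem_piFinset.mpr fun i => Finset.mem_range.mpr ?_, funext fun i => ?_⟩
  · have hi := h i; omega
  · have hi := h i; simp only [toSite]; omega

/-- [folklore] `hA` (tower spelling). -/
theorem tower_spr_A {r : ℕ → (Fin (d + 1) → ℕ)} (hr : ∀ k, r k ∈ box (d + 1) Lc) (m : ℕ) {rs : ℕ → (Fin (d + 1) → ℕ)}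
    (hrs : ∀ k i, 0 ≤ toSite (rs k) i ∧ toSite (rs k) i < (Lc : ℤ)) :
    Spr (comp (comp (psiK r Lc (m + 1)) (coDressKBmAt (bigRoot Lc rs m) (Lc ^ (m + 1)) (KInv (N := Lc ^ (m + 1)) (d := d)))) (trK (psiK r Lc (m + 1)))) := by
  obtain ⟨s, hs, hse⟩ := exists_box_toSite_eq_bigRoot Lc rs hrs m
  rw [← hse]
  exact spr_compositeA (Nat.pos_of_ne_zero (NeZero.ne Lc)) hr (m + 1) hs

/-- [folklore] `hMh` (tower spelling). -/
theorem tower_spr_M {r : ℕ → (Fin (d + 1) → ℕ)} (hr : ∀ k, r k ∈ box (d + 1) Lc) (m : ℕ) : Spr (bhKcomp (d := d) r Lc (m + 1)) :=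
  spr_bhKcomp (Nat.pos_of_ne_zero (NeZero.ne Lc)) hr (m + 1)

/-- [folklore] `hAt` (tower spelling). -/
theorem tower_shiftK_A (r : ℕ → (Fin (d + 1) → ℕ)) (m : ℕ) (rs : ℕ → (Fin (d + 1) → ℕ)) (t : Fin (d + 1) → ℤ) :
    shiftK ((((Lc ^ (m + 1) : ℕ) : ℤ)) • t)
        (comp (comp (psiK r Lc (m + 1)) (coDressKBmAt (bigRoot Lc rs m) (Lc ^ (m + 1)) (KInv (N := Lc ^ (m + 1)) (d := d)))) (trK (psiK r Lc (m + 1)))) =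
      comp (comp (psiK r Lc (m + 1)) (coDressKBmAt (bigRoot Lc rs m) (Lc ^ (m + 1)) (KInv (N := Lc ^ (m + 1)) (d := d)))) (trK (psiK r Lc (m + 1))) :=
  shiftK_compositeA (Nat.one_le_iff_ne_zero.mpr (NeZero.ne Lc)) r (m + 1) (bigRoot Lc rs m) t

/-- [folklore] `hMt` (tower spelling). -/
theorem tower_shiftK_M (r : ℕ → (Fin (d + 1) → ℕ)) (m : ℕ) (t : Fin (d + 1) → ℤ) :
    shiftK ((((Lc ^ (m + 1) : ℕ) : ℤ)) • t) (bhKcomp (d := d) r Lc (m + 1)) = bhKcomp r Lc (m + 1) :=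
  shiftK_bhKcomp (Nat.one_le_iff_ne_zero.mpr (NeZero.ne Lc)) r (m + 1) t

/-- [folklore] `hrel` (tower spelling): K-U3d's `relInv_composite` at the big root of the tower. -/
theorem tower_relInv {r : ℕ → (Fin (d + 1) → ℕ)} (hr : ∀ k, r k ∈ box (d + 1) Lc) (m : ℕ) {rs : ℕ → (Fin (d + 1) → ℕ)}
    (hrs : ∀ k i, 0 ≤ toSite (rs k) i ∧ toSite (rs k) i < (Lc : ℤ)) :
    RelInv (comp (comp (psiK r Lc (m + 1)) (coDressKBmAt (bigRoot Lc rs m) (Lc ^ (m + 1)) (KInv (N := Lc ^ (m + 1)) (d := d)))) (trK (psiK r Lc (m + 1))))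
      (bhKcomp r Lc (m + 1)) (axEc (bigRoot Lc rs m) (Lc ^ (m + 1))) := by
  obtain ⟨s, hs, hse⟩ := exists_box_toSite_eq_bigRoot Lc rs hrs m
  rw [← hse]
  exact relInv_composite (Nat.pos_of_ne_zero (NeZero.ne Lc)) r hr hs

omit [NeZero Lc] in
/-- [folklore] `hmm` (tower spelling). -/
theorem tower_mm (r : ℕ → (Fin (d + 1) → ℕ)) (m : ℕ) (x y : Fin (d + 1) → ℤ) (κ l : Fin (d + 1)) : bhKcomp r Lc (m + 1) x y (Sum.inr κ) (Sum.inr l) = 0 :=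
  bhKcomp_inr_inr r (m + 1) x y κ l

/-- [folklore] `hanti` (tower spelling). -/
theorem tower_anti (r : ℕ → (Fin (d + 1) → ℕ)) (m : ℕ) (x y : Fin (d + 1) → ℤ) (κ l : Fin (d + 1)) :
    bhKcomp r Lc (m + 1) x y (Sum.inl κ) (Sum.inr l) = -bhKcomp r Lc (m + 1) y x (Sum.inr l) (Sum.inl κ) :=
  bhKcomp_inl_inr_eq_neg (Nat.pos_of_ne_zero (NeZero.ne Lc)) r (m + 1) x y κ l

end Tower

/-! ## §3 The `hH` block identification at the torus, full depth -/

section TorusFF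

open B6Lemma24Torus (pbox)
open Summit.QuantumFields.BalabanUV.Beta.FP.KernelPeriodisationFib (Idx perF perF_apply perZ_apply)

/-- [folklore] **THE `ff` SUBMATRIX OF A PERIODISED KERNEL SEES ONLY THE KERNEL's `ff` BLOCK**: two kernels with the same field–field entries have the same
periodised `ff` submatrix on every torus box (`perZ M K x y a b = Σ'_m K x (translate M y m) a b` keeps the fibre indices). -/
theorem perF_submatrix_inl_inl_congr {K K' : MKer (d + 1) (Fib d)} (h : ∀ (x y : Fin (d + 1) → ℤ) (κ β : Fin (d + 1)), K x y (Sum.inl κ) (Sum.inl β) = K' x y (Sum.inl κ) (Sum.inl β))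
    (M : Fin (d + 1) → ℕ) :
    (perF M K).submatrix (fun b : ↥(pbox M) × Fin (d + 1) => ((b.1, Sum.inl b.2) : Idx M (Fib d)))
        (fun b : ↥(pbox M) × Fin (d + 1) => ((b.1, Sum.inl b.2) : Idx M (Fib d))) =
      (perF M K').submatrix (fun b : ↥(pbox M) × Fin (d + 1) => ((b.1, Sum.inl b.2) : Idx M (Fib d)))
        (fun b : ↥(pbox M) × Fin (d + 1) => ((b.1, Sum.inl b.2) : Idx M (Fib d))) := by
  ext b b'
  simp only [Matrix.submatrix_apply, perF_apply, perZ_apply, h]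

/-- [folklore] **THE (C1)-0 `hH` JUNCTION AT THE TORUS, FULL DEPTH** — leaf-05 §1's ∕ #41d's `hH : (perF T 𝕄_X)|ff = H₀` with `𝕄_X := bhKcomp r L m` and
`H₀ := (perF T (bhKStepAt d ρ Lc 0))|ff` (#41d's `hH₀` at `lev (n+1) = 0`), for EVERY torus box `T`, root `ρ` and one-step ratio `Lc`: the two `ff` submatrices coincide
(`bhKcomp_inl_inl_eq_bhKStepAt_zero` under `perF_submatrix_inl_inl_congr`). -/
theorem perF_bhKcomp_submatrix_inl_inl_eq {L : ℕ} (hL : 0 < L) (r : ℕ → (Fin (d + 1) → ℕ)) (m : ℕ) (ρ : Fin (d + 1) → ℤ) (Lc : ℕ) [NeZero Lc]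
    (T : Fin (d + 1) → ℕ) :
    (perF T (bhKcomp (d := d) r L m)).submatrix (fun b : ↥(pbox T) × Fin (d + 1) => ((b.1, Sum.inl b.2) : Idx T (Fib d)))
        (fun b : ↥(pbox T) × Fin (d + 1) => ((b.1, Sum.inl b.2) : Idx T (Fib d))) =
      (perF T (bhKStepAt d ρ Lc 0)).submatrix (fun b : ↥(pbox T) × Fin (d + 1) => ((b.1, Sum.inl b.2) : Idx T (Fib d)))
        (fun b : ↥(pbox T) × Fin (d + 1) => ((b.1, Sum.inl b.2) : Idx T (Fib d))) :=
  perF_submatrix_inl_inl_congr (fun x y κ β => bhKcomp_inl_inl_eq_bhKStepAt_zero hL r m ρ Lc x y κ β) T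

end TorusFF

end

end Summit.QuantumFields.BalabanUV.Beta.CompositeOneShotChart
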